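import Summits.Ventures.YMGap.RobustBall.RobustAreaLawUpTo
import Summits.Ventures.YMGap.RobustBall.StringTensionOnBallW
import Literature.Barriers.QuantumFields.AbelianDeconfinementD4
import HarnessLib

/-!
# Robust ball (Y2), area-law side — NO PERIMETER LAW anywhere on the ball (an unconditional confinement-type statement)

HONEST FRAMING: venture file of the cell `pub-ymgap` (QuantumFields programme), track ROBUST-BALL, seat rb-p2 (g2).  Strong-coupling LATTICE
statements; nothing about the continuum, a spectral mass gap, or Clay.

WHAT.  The string-tension clause of `StringTensionOnBall` is conditional on the EXISTENCE of the string tension (not claimed for members).  An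
UNCONDITIONAL confinement-type reading of the same area law uses the tree's dichotomy lemma `HasPerimeterLaw.not_hasAreaLawState`
(`Literature/Barriers/QuantumFields/AbelianDeconfinementD4`: a perimeter-law lower bound `W(R,T) ≥ e^{−c'·2(R+T)}` — the Wilson-criterion signature of
the deconfined / Coulomb phase, tree `HasPerimeterLaw` — is incompatible with an area law): under `AreaLawOnBall` (resp. `AreaLawOnBallW`, resp. the UpTo
form) NO infinite-volume limit state of ANY eventually-member family obeys a perimeter law (`not_hasPerimeterLaw_onBall`, `…_onBallW`, `…_onBallUpTo`);
`SU(2)`, `d = 4` instances: the `β_W = 1/3` ball `(3/10, 3/20)` at every coupling `0 ≤ β_W ≤ 1/3`, and the `1×2`-rectangle family (`|τ| ≤ 1/2000`).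
NOT CLAIMED: existence of the string tension; anything at couplings beyond the door's window.
-/

noncomputable section

open MeasureTheory Filter Topology
open Literature.MathematicalPhysics.QuantumLattice
open Literature.MathematicalPhysics.QuantumFieldTheory hiding ZdEdge Site

namespace Summit.Ventures.YMGap.RobustBall

variable {d N : ℕ}

/-- **NO PERIMETER LAW ON THE BALL (tier 1).**  Under `AreaLawOnBall N d β ε₀ ε₁ r mv` (`d ≥ 2`), no infinite-volume limit state of any family eventually
in `ClusterDomainFR ε₀ ε₁ r ∩ IsSlabLocal mv` satisfies the tree's `HasPerimeterLaw μ χ_N` (`∃ c', ∀ R T ≥ 1, e^{−c'·2(R+T)} ≤ W_μ(R,T)`): the area law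
of the limit state (`stringTension_onBall`) excludes it (`HasPerimeterLaw.not_hasAreaLawState`). Unconditional. [folklore] -/
theorem not_hasPerimeterLaw_onBall [NeZero d] (hd : 2 ≤ d) {β ε₀ ε₁ : ℝ} {r mv : ℕ} (h : AreaLawOnBall N d β ε₀ ε₁ r mv)
    (𝓦 : PerturbationFamily d N) (h𝓦 : ∀ᶠ L : ℕ in atTop, 𝓦 L ∈ ClusterDomainFR ε₀ ε₁ r ∧ IsSlabLocal mv (𝓦 L))
    {μ : Measure (LGConfig d (SUN N))} (hμ : μ ∈ perturbedLimitPoints β 𝓦) :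
    ¬ HasPerimeterLaw μ (fun g => normalisedCharacter N (fundamentalRep (Fin N) g)) := by
  obtain ⟨C, c, _, hA⟩ := stringTension_onBall hd h
  exact fun hP => hP.not_hasAreaLawState (hA 𝓦 h𝓦 μ hμ).2.1

/-- **NO PERIMETER LAW ON THE TIER-2 BALL.**  The same from `AreaLawOnBallW N d β κ ε₀ ε₁ mv` for families eventually in
`ClusterDomain κ ε₀ ε₁ ∩ IsSlabLocal mv`. [folklore] -/
theorem not_hasPerimeterLaw_onBallW [NeZero d] (hd : 2 ≤ d) {β κ ε₀ ε₁ : ℝ} {mv : ℕ} (h : AreaLawOnBallW N d β κ ε₀ ε₁ mv)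
    (𝓦 : PerturbationFamily d N) (h𝓦 : ∀ᶠ L : ℕ in atTop, 𝓦 L ∈ ClusterDomain κ ε₀ ε₁ ∧ IsSlabLocal mv (𝓦 L))
    {μ : Measure (LGConfig d (SUN N))} (hμ : μ ∈ perturbedLimitPoints β 𝓦) :
    ¬ HasPerimeterLaw μ (fun g => normalisedCharacter N (fundamentalRep (Fin N) g)) := by
  obtain ⟨C, c, _, hA⟩ := stringTension_onBallW hd h
  exact fun hP => hP.not_hasAreaLawState (hA 𝓦 h𝓦 μ hμ).2.1

/-- **NO PERIMETER LAW, UNIFORMLY IN THE COUPLING (UpTo form).**  Under the UpTo torus area law on `0 ≤ β ≤ β⋆` (`RobustAreaLawUpTo`), for every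
`β ∈ [0, β⋆]` no limit state of any eventually-member family at coupling `β` obeys a perimeter law. [folklore] -/
theorem not_hasPerimeterLaw_onBallUpTo [NeZero d] (hd : 2 ≤ d) {βs ε₀ ε₁ : ℝ} {r mv : ℕ}
    (h : ∃ C c : ℝ, 0 < c ∧ ∀ β : ℝ, 0 ≤ β → β ≤ βs → ∀ (L : ℕ) [NeZero L] (W : Perturbation d L N),
      W ∈ ClusterDomainFR ε₀ ε₁ r → IsSlabLocal mv W → ∀ (x : Literature.MathematicalPhysics.QuantumFieldTheory.Site d L) (i j : Fin d) (R' T : ℕ), i ≠ j → 1 ≤ R' → 1 ≤ T →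
        2 * R' ≤ L → 2 * T ≤ L →
          |W.expectation (fundamentalRep (Fin N)) β (wilsonLoop (fundamentalRep (Fin N)) x i j R' T)| ≤
            C ^ (2 * (R' + T)) * Real.exp (-c * ((R' : ℝ) * T)))
    {β : ℝ} (hβ0 : 0 ≤ β) (hβ : β ≤ βs) (𝓦 : PerturbationFamily d N)
    (h𝓦 : ∀ᶠ L : ℕ in atTop, 𝓦 L ∈ ClusterDomainFR ε₀ ε₁ r ∧ IsSlabLocal mv (𝓦 L))
    {μ : Measure (LGConfig d (SUN N))} (hμ : μ ∈ perturbedLimitPoints β 𝓦) :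
    ¬ HasPerimeterLaw μ (fun g => normalisedCharacter N (fundamentalRep (Fin N) g)) :=
  not_hasPerimeterLaw_onBall hd (areaLawOnBall_of_upTo h hβ0 hβ) 𝓦 h𝓦 hμ

/-! ### `SU(2)`, `d = 4` instances -/

/-- **`SU(2)`, `d = 4`, ball `(3/10, 3/20)`, EVERY coupling `0 ≤ β_W ≤ 1/3` (tree `β ≤ 1/6`)**: no infinite-volume limit state of any eventually-member
family obeys a perimeter law. [folklore] -/
theorem su2_not_hasPerimeterLaw_onBallUpTo_oneThird (r : ℕ) {mv : ℕ} (hmv : 1 ≤ mv) {β : ℝ} (hβ0 : 0 ≤ β) (hβ : β ≤ 1 / 6)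
    (𝓦 : PerturbationFamily 4 2) (h𝓦 : ∀ᶠ L : ℕ in atTop, 𝓦 L ∈ ClusterDomainFR (3 / 10) (3 / 20) r ∧ IsSlabLocal mv (𝓦 L))
    {μ : Measure (LGConfig 4 (SUN 2))} (hμ : μ ∈ perturbedLimitPoints β 𝓦) :
    ¬ HasPerimeterLaw μ (fun g => normalisedCharacter 2 (fundamentalRep (Fin 2) g)) :=
  not_hasPerimeterLaw_onBallUpTo (by norm_num) (su2_areaLawOnBallUpTo_oneThird r hmv) hβ0 hβ 𝓦 h𝓦 hμ

/-- **The rectangle-perturbed `SU(2)` action (`|τ| ≤ 1/2000`) at any coupling `0 ≤ β_W ≤ 1/3`: NO PERIMETER LAW in any infinite-volume limit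
state** (the set of limit states is non-empty at every coupling). Unconditional. [folklore] -/
theorem su2_rectangle_not_hasPerimeterLaw (τ : ℝ) (hτ : |τ| ≤ 1 / 2000) {β : ℝ} (hβ0 : 0 ≤ β) (hβ : β ≤ 1 / 6)
    {μ : Measure (LGConfig 4 (SUN 2))}
    (hμ : μ ∈ perturbedLimitPoints β (fun L : ℕ => termPerturbation (rectFamily 4 (L + 1) 2 τ))) :
    ¬ HasPerimeterLaw μ (fun g => normalisedCharacter 2 (fundamentalRep (Fin 2) g)) :=
  su2_not_hasPerimeterLaw_onBallUpTo_oneThird 2 (mv := 2) (by norm_num) hβ0 hβ _ (rectangle_eventually_mem τ hτ) hμ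

end Summit.Ventures.YMGap.RobustBall

end
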